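import Literature.NumberTheory.EllipticCurves.SwanConductorTorsionDichotomyProofs
import Literature.NumberTheory.EllipticCurves.PotentialGoodReductionLegendreProofs
import Literature.NumberTheory.EllipticCurves.TwoTorsionCardProofs
import Literature.NumberTheory.EllipticCurves.HasseWeilAbelianTameIntegralJProofs
import Literature.NumberTheory.GaloisRepresentations.CubicEisensteinRamificationTotallyRamifiedProofs
import Literature.NumberTheory.GaloisRepresentations.RamificationFiltrationTowerProofs
import HarnessLib

/-!
# `Sw_𝔓(V₂ E) = v(disc) - 2` when the `2`-division field is generated by an Eisenstein cubic at a
# place of residue characteristic `3` (Silverman *ATAEC* IV.11.1, proof for `p = 3`)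

`Proofs` file (theorems only, no definitions, no named facts), landed by the seat of bsd.S15
(`Literature.NumberTheory.EllipticCurves.conductorNorm_eq_artinConductorNat_of_isElliptic`)
toward the wild Kodaira types `II`, `IV`, `IV*`, `II*` of
`WeierstrassCurve.swanConductorAt_rationalTate_eq_wildConductorExponent_of_ringChar_eq_three`
(Ogg's formula at `p = 3`): the **Galois-theoretic half** of Silverman's proof, i.e. the value of
the wild part of the conductor of `V₂ E` at a prime `𝔓 ∣ v`, `v ∣ 3`, in terms of the
discriminant of an Eisenstein cubic generating the `2`-division field.

* `WeierstrassCurve.smul_two_torsion_eq_of_smul_roots_eq` — an element of `Γ_K` fixing the three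
  roots `eᵢ` of the `2`-division cubic fixes `E[2]` (the points of order `2` are `(eᵢ, yᵢ)` with
  `2yᵢ = -(a₁eᵢ + a₃)`);
* `WeierstrassCurve.swanConductorAt_rationalTate_two_eq_of_eisenstein` — **main theorem**: for
  `F/K` finite Galois inside `K̄` containing the `eᵢ`, with `Gal(F/K)` faithful on them, and
  algebraic integers `θ₁, θ₂, θ₃ ∈ F`, distinct, roots of `X³ + c₂X² + c₁X + c₀ ∈ 𝓞_K[X]`
  Eisenstein at `v` (residue characteristic `3`), such that fixing the `θᵢ` fixes the `eᵢ`: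
  `Sw_𝔓(V₂ E) = v(disc) - 2`, `disc = c₂²c₁² - 4c₁³ - 4c₂³c₀ - 27c₀² + 18c₂c₁c₀`.

Proof: `Sw_𝔓(V₂ E) = Σ_{i≥1} (#G_i/#G_0)·(2 if G_i moves E[2], else 0)` over `Gal(F/K)`
(`swanConductorAt_rationalTate_eq_finsum_ite`, `SwanConductorTorsionDichotomyProofs`); `G_i` moves
`E[2]` iff `G_i ≠ 1` (faithfulness; `smul_eq_self_of_forall_smul_two_torsion_eq`); and the lower
filtration of `𝔓 ∩ F` is given by
`Literature.NumberTheory.GaloisRepresentations.exists_break`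
(`CubicEisensteinRamification*Proofs`: `G_i ≠ 1 ↔ i ≤ b`, `#G_i = 3`, `6b = #G₀ (v(disc) - 2)`).
This is *ATAEC* p. 370, *"`δ(E/M) = Σ (g_i/g_0) dim(E[2]/E[2]^{G_i}) = 2(r - 1) = v_M(Δ) - 4`"*
with `δ(E/K) = δ(E/M)/e(M/K)` (p. 367), uniformly in the degree of the `2`-division field.  The
per-type curve side (an Eisenstein generator: `e`, `e²/π`, `e/π`, `e²/π³` for types `II`, `IV`,
`IV*`, `II*` at a minimal model, with `v(disc) = v(Δ)`, `v(Δ) - 2`, `v(Δ) - 6`, `v(Δ) - 8`) is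
the object of sequels.

No definitions, no named facts.  All axioms `propext`, `Classical.choice`, `Quot.sound`.

## References

* J. H. Silverman, *Advanced Topics in the Arithmetic of Elliptic Curves*, GTM 151 (1994), proof of
  Thm. IV.11.1 for `p = 3` (PDF pp. 366–370); *AEC* III §2. [SilvermanATAEC1994] [SilvermanAEC2009]
* J.-P. Serre, *Local Fields*, GTM 67 (1979), Ch. IV §1 and Ch. VI §2 Cor. 1'. [SerreLocalFields1979]
-/

noncomputable section

open scoped Classical NumberField
open Field IsDedekindDomain Polynomial

universe u

namespace WeierstrassCurve

open Literature.NumberTheory.EllipticCurves Literature.NumberTheory.GaloisRepresentations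
  IsDedekindDomain.HeightOneSpectrum

variable {K : Type u} [Field K] [NumberField K] (W : WeierstrassCurve K)

/-- **The `2`-torsion is fixed by an automorphism fixing the roots of the `2`-division cubic.**
For an elliptic curve `E/K` (`char K = 0`) and `σ ∈ Γ_K` fixing the three roots `e₁, e₂, e₃ ∈ K̄`
of `4x³ + b₂x² + 2b₄x + b₆`, `σ` fixes every `P ∈ E(K̄)` with `2P = O`: such a `P ≠ O` is
`(x, y)` with `x` a root (`isRoot_twoTorsionPolynomial_of_add_self_eq_zero`) and
`2y = -(a₁x + a₃)`.  Silverman *AEC* III.§2 and Ex. 3.7. [cite: SilvermanAEC2009, III.§2 (2.3(d)) and Exercise 3.7] -/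
theorem smul_two_torsion_eq_of_smul_roots_eq [W.IsElliptic] {e₁ e₂ e₃ : AlgebraicClosure K}
    (h3 : (Cubic.map (algebraMap K (AlgebraicClosure K)) W.twoTorsionPolynomial).roots = {e₁, e₂, e₃})
    {σ : absoluteGaloisGroup K} (h₁ : σ • e₁ = e₁) (h₂ : σ • e₂ = e₂) (h₃ : σ • e₃ = e₃)
    (P : geomPoints W) (hP : (2 : ℕ) • P = 0) : σ • P = P := by
  rcases P with _ | ⟨x, y, hxy⟩
  · exact smul_zero σ
  · have hadd : Affine.Point.some x y hxy + Affine.Point.some x y hxy = 0 := by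
      rwa [two_nsmul] at hP
    obtain ⟨hy, hroot⟩ :=
      (W.baseChange (AlgebraicClosure K)).isRoot_twoTorsionPolynomial_of_add_self_eq_zero hadd
    -- `x` is one of the `eᵢ`
    have ha : W.twoTorsionPolynomial.a ≠ 0 := by
      show (4 : K) ≠ 0
      norm_num
    have hprod := Cubic.eq_prod_three_roots ha h3
    have hmap : (W.baseChange (AlgebraicClosure K)).twoTorsionPolynomial.toPoly =
        (Cubic.map (algebraMap K (AlgebraicClosure K)) W.twoTorsionPolynomial).toPoly := by
      rw [Cubic.map_toPoly]
      simp [twoTorsionPolynomial, baseChange, Cubic.toPoly, map_b₂, map_b₄, map_b₆, map_ofNat]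
    rw [hmap, hprod] at hroot
    simp only [IsRoot.def, eval_mul, eval_C, eval_sub, eval_X, mul_eq_zero, sub_eq_zero] at hroot
    have h4 : algebraMap K (AlgebraicClosure K) W.twoTorsionPolynomial.a ≠ 0 := by
      rw [show W.twoTorsionPolynomial.a = 4 from rfl, map_ofNat]; norm_num
    have hx : σ • x = x := by
      rcases hroot with ((hx | hx) | hx) | hx
      · exact absurd hx h4
      · rw [hx, h₁]
      · rw [hx, h₂]
      · rw [hx, h₃]
    -- `y = -(a₁ x + a₃)/2` is then fixed too
    have hy' : 2 * y = -((W.baseChange (AlgebraicClosure K)).a₁ * x +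
        (W.baseChange (AlgebraicClosure K)).a₃) := by
      rw [Affine.negY] at hy
      linear_combination hy
    have ha1 : σ • (W.baseChange (AlgebraicClosure K)).a₁ = (W.baseChange (AlgebraicClosure K)).a₁ := by
      rw [baseChange, map_a₁]; exact smul_algebraMap σ W.a₁
    have ha3 : σ • (W.baseChange (AlgebraicClosure K)).a₃ = (W.baseChange (AlgebraicClosure K)).a₃ := by
      rw [baseChange, map_a₃]; exact smul_algebraMap σ W.a₃
    have hyσ : σ • y = y := by
      have h2y : σ • (2 * y) = 2 * y := by
        rw [hy', smul_neg, smul_add, smul_mul', hx, ha1, ha3]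
      rw [smul_mul'] at h2y
      have h2 : σ • (2 : AlgebraicClosure K) = 2 := by
        rw [show (2 : AlgebraicClosure K) = algebraMap K _ 2 by rw [map_ofNat]]
        exact smul_algebraMap σ (2 : K)
      rw [h2] at h2y
      exact mul_left_cancel₀ two_ne_zero h2y
    change Affine.Point.map _ (Affine.Point.some x y hxy) = _
    rw [Affine.Point.map_some]
    congr 1

variable {W}

/-- The restriction `Γ_K → Gal(F/K)` is onto (Mathlib `AlgEquiv.restrictNormalHom_surjective`).
[folklore] -/
theorem absRestrictNormalHom_surjective' (F : IntermediateField K (AlgebraicClosure K)) [Normal K F] :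
    Function.Surjective (absRestrictNormalHom (K := K) F) := fun τ ↦ by
  obtain ⟨σ, hσ⟩ := AlgEquiv.restrictNormalHom_surjective (F := K) (K₁ := F)
    (E := AlgebraicClosure K) τ
  exact ⟨(absoluteGaloisGroup.toAlgEquiv K).symm σ, hσ⟩

variable (W)

/-- **`Sw_𝔓(V₂ E) = v(disc) - 2` from the ramification of an Eisenstein cubic generating the
`2`-division field, at a place of residue characteristic `3`.**  Let `E/K` be an elliptic curve
over a number field, `v` a finite place of residue characteristic `3`, `𝔓 ∣ v` a prime of
`\bar ℤ_K`, and `F ⊆ K̄` a finite Galois extension of `K` containing the three roots `eᵢ` of the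
`2`-division cubic `4x³ + b₂x² + 2b₄x + b₆` on which `Gal(F/K)` acts faithfully (e.g. the
`2`-division field `K(E[2]) = K(e₁, e₂, e₃)`).  Suppose `F` contains algebraic integers
`θ₁, θ₂, θ₃`, distinct, with `∏(X - θᵢ) = X³ + c₂X² + c₁X + c₀`, `cᵢ ∈ 𝓞 K`, **Eisenstein at `v`**
(`c₂, c₁, c₀ ∈ v`, `c₀ ∉ v²`), such that an element of `Gal(F/K)` fixing the `θᵢ` fixes the `eᵢ`
(e.g. `θᵢ = eᵢ`, or `θᵢ = eᵢ²/π` when the cubic is irreducible).  Then for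
`n = v(c₂²c₁² - 4c₁³ - 4c₂³c₀ - 27c₀² + 18c₂c₁c₀)` (`≥ 3`):

  `Sw_𝔓(V₂ E) = n - 2`.

Proof: the book's definition of `δ` with its summands evaluated,
`Sw_𝔓(V₂ E) = Σ_{i ≥ 1} (#G_i/#G_0) · (2 if G_i moves E[2], else 0)`
(`swanConductorAt_rationalTate_eq_finsum_ite`, `L = F`: an element of `Γ_K` trivial on `F` fixes
the `eᵢ`, hence `E[2]`, `smul_two_torsion_eq_of_smul_roots_eq`); `G_i` moves `E[2]` iff `G_i ≠ 1`
(faithfulness and `smul_eq_self_of_forall_smul_two_torsion_eq`); and the filtration of `𝔓 ∩ F` is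
that of the splitting field of an Eisenstein cubic in residue characteristic `3`
(`Literature.NumberTheory.GaloisRepresentations.exists_break`: `G_i ≠ 1 ↔ i ≤ b`, `#G_i = 3`,
`6b = #G₀ (n - 2)`), so the sum is `b · 6/#G₀ = n - 2`.  This is the displayed computation
`δ(E/M) = Σ (g_i/g_0) dim(E[2]/E[2]^{G_i}) = 2(r-1) = v_M(Δ) - 4` of Silverman's proof of Ogg's
formula for `p = 3` (*ATAEC* PDF p. 370), together with `δ(E/K) = δ(E/M)/e(M/K)` (p. 367), for
the four wild Kodaira types at once.
[cite: SilvermanATAEC1994, proof of Thm. IV.11.1 for p = 3 (PDF pp. 366–370)]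
[cite: SerreLocalFields1979, Ch. IV §1 and Ch. VI §2 Cor. 1'] -/
theorem swanConductorAt_rationalTate_two_eq_of_eisenstein [W.IsElliptic]
    (h : Continuous fun x : absoluteGaloisGroup K × RationalTateModule (geomPoints W) 2 ↦
      rationalTateRepresentation (absoluteGaloisGroup K) (geomPoints W) 2 x.1 x.2)
    {v : HeightOneSpectrum (𝓞 K)} (hv3 : ringChar (𝓞 K ⧸ v.asIdeal) = 3)
    {𝔓 : Ideal (absIntegers (𝓞 K) K)} (h𝔓 : 𝔓 ∈ v.primesAbove)
    (F : IntermediateField K (AlgebraicClosure K)) [FiniteDimensional K F] [IsGalois K F]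
    {e₁ e₂ e₃ : AlgebraicClosure K}
    (he : (Cubic.map (algebraMap K (AlgebraicClosure K)) W.twoTorsionPolynomial).roots = {e₁, e₂, e₃})
    (he₁ : e₁ ∈ F) (he₂ : e₂ ∈ F) (he₃ : e₃ ∈ F)
    (hFgen : ∀ g : F ≃ₐ[K] F, g ⟨e₁, he₁⟩ = ⟨e₁, he₁⟩ → g ⟨e₂, he₂⟩ = ⟨e₂, he₂⟩ →
      g ⟨e₃, he₃⟩ = ⟨e₃, he₃⟩ → g = 1)
    {θ₁ θ₂ θ₃ : integralClosure (𝓞 K) F} {c₂ c₁ c₀ : 𝓞 K}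
    (hV₁ : θ₁ + θ₂ + θ₃ = -algebraMap (𝓞 K) _ c₂)
    (hV₂ : θ₁ * θ₂ + θ₁ * θ₃ + θ₂ * θ₃ = algebraMap (𝓞 K) _ c₁)
    (hV₃ : θ₁ * θ₂ * θ₃ = -algebraMap (𝓞 K) _ c₀)
    (hc₂ : c₂ ∈ v.asIdeal) (hc₁ : c₁ ∈ v.asIdeal) (hc₀ : c₀ ∈ v.asIdeal) (hc₀' : c₀ ∉ v.asIdeal ^ 2)
    (h12 : θ₁ ≠ θ₂) (h13 : θ₁ ≠ θ₃) (h23 : θ₂ ≠ θ₃)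
    (hθe : ∀ g : F ≃ₐ[K] F, g • θ₁ = θ₁ → g • θ₂ = θ₂ → g • θ₃ = θ₃ →
      g ⟨e₁, he₁⟩ = ⟨e₁, he₁⟩ ∧ g ⟨e₂, he₂⟩ = ⟨e₂, he₂⟩ ∧ g ⟨e₃, he₃⟩ = ⟨e₃, he₃⟩)
    {n : ℕ} (hn : ord v.asIdeal (c₂ ^ 2 * c₁ ^ 2 - 4 * c₁ ^ 3 - 4 * c₂ ^ 3 * c₀ - 27 * c₀ ^ 2 +
      18 * c₂ * c₁ * c₀) = n) :
    (rationalTateGaloisRepOf (geomPoints W) 2 h).swanConductorAt (𝓞 K) 𝔓 = ((n - 2 : ℕ) : ℝ) := by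
  haveI : Fact (Nat.Prime 2) := ⟨Nat.prime_two⟩
  haveI h𝔓max : 𝔓.IsMaximal := isMaximal_of_mem_primesAbove h𝔓
  -- the residue characteristic: `2 ∉ v`, `3 ∈ v`
  have h2v : ((2 : ℕ) : 𝓞 K) ∉ v.asIdeal :=
    v.natCast_notMem_of_ringChar_ne Nat.prime_two (by rw [hv3]; decide)
  have h3v : (3 : 𝓞 K) ∈ v.asIdeal := by
    have := v.natCast_ringChar_mem
    rwa [hv3] at this
  -- the prime `𝔓 ∩ F` of `S = integralClosure (𝓞 K) F` and its data
  have hunder : (𝔓.comap (F.integralClosureToAbsIntegers (𝓞 K))).under (𝓞 K) = v.asIdeal := by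
    rw [under_comap_integralClosureToAbsIntegers, ← h𝔓.2.over]
  haveI : (𝔓.comap (F.integralClosureToAbsIntegers (𝓞 K))).IsMaximal :=
    isMaximal_comap_integralClosureToAbsIntegers (𝓞 K) 𝔓 F
  haveI : Finite ((𝓞 K) ⧸ 𝔓.under (𝓞 K)) := by
    rw [← h𝔓.2.over]
    exact Ideal.finiteQuotientOfFreeOfNeBot v.asIdeal v.ne_bot
  haveI := isSeparable_residue_comap (𝓞 K) 𝔓 F
  have h3F : (3 : 𝓞 K) ∈ (𝔓.comap (F.integralClosureToAbsIntegers (𝓞 K))).under (𝓞 K) := by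
    rw [hunder]; exact h3v
  have h𝔓F0 : (𝔓.comap (F.integralClosureToAbsIntegers (𝓞 K))) ≠ ⊥ := by
    intro h0
    have hinj : Function.Injective (algebraMap (𝓞 K) (integralClosure (𝓞 K) F)) :=
      (faithfulSMul_iff_algebraMap_injective _ _).mp
        (faithfulSMul_integralClosure (𝓞 K) (K := K) (L := F))
    have h3' := h3F
    rw [Ideal.under_def, Ideal.mem_comap, h0, Ideal.mem_bot, ← map_zero (algebraMap (𝓞 K) _)] at h3'
    exact (by norm_num : (3 : 𝓞 K) ≠ 0) (hinj h3')
  -- faithfulness of `Gal(F/K)` on the `θᵢ`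
  have hfaith : ∀ g : F ≃ₐ[K] F, g • θ₁ = θ₁ → g • θ₂ = θ₂ → g • θ₃ = θ₃ → g = 1 :=
    fun g g1 g2 g3 ↦ by
      obtain ⟨f1, f2, f3⟩ := hθe g g1 g2 g3
      exact hFgen g f1 f2 f3
  -- the filtration of `𝔓 ∩ F`
  obtain ⟨b, n', hb1, hne, hcard3, hn', h6b, hn3⟩ := exists_break (K := K)
    (𝔓.comap (F.integralClosureToAbsIntegers (𝓞 K))) h𝔓F0 h3F hV₁ hV₂ hV₃
    (hunder ▸ hc₂) (hunder ▸ hc₁) (hunder ▸ hc₀) (by rw [hunder]; exact hc₀') h12 h13 h23 hfaith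
  rw [hunder, hn] at hn'
  have hnn : n' = n := by exact_mod_cast hn'.symm
  rw [hnn] at h6b hn3
  clear hn' hnn
  -- `σ ∈ Γ_K` trivial on `F` fixes `E[2]`; `σ` fixing `E[2]` restricts to an element fixing the `eᵢ`
  have hres : ∀ (σ : absoluteGaloisGroup K) (x : F),
      ((absRestrictNormalHom F σ x : F) : AlgebraicClosure K) = σ • (x : AlgebraicClosure K) :=
    fun σ x ↦ AlgEquiv.restrictNormal_commutes (absoluteGaloisGroup.toAlgEquiv K σ) F x
  have hL : ∀ σ : absoluteGaloisGroup K, absRestrictNormalHom F σ = 1 →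
      ∀ P : geomTorsion W (2 : ℕ), σ • P = P := by
    intro σ hσ P
    have hfix : ∀ {x : AlgebraicClosure K}, x ∈ F → σ • x = x := fun {x} hx ↦ by
      have := hres σ ⟨x, hx⟩
      rw [hσ, AlgEquiv.one_apply] at this
      exact this.symm
    exact Subtype.ext (W.smul_two_torsion_eq_of_smul_roots_eq he (hfix he₁) (hfix he₂) (hfix he₃) _
      ((AddSubgroup.torsionBy.nsmul_iff (A := geomPoints W)).mp P.2))
  -- `G_i` moves `E[2]` iff `G_i ≠ 1`
  have hcond : ∀ i : ℕ,
      (∃ σ : absoluteGaloisGroup K, absRestrictNormalHom F σ ∈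
          (𝔓.comap (F.integralClosureToAbsIntegers (𝓞 K))).ramificationSubgroup (F ≃ₐ[K] F) i ∧ ∃ T : geomTorsion W (2 : ℕ), σ • T ≠ T) ↔
        (𝔓.comap (F.integralClosureToAbsIntegers (𝓞 K))).ramificationSubgroup (F ≃ₐ[K] F) i ≠ ⊥ := by
    intro i
    constructor
    · rintro ⟨σ, hσ, T, hT⟩ hbot
      rw [hbot, Subgroup.mem_bot] at hσ
      exact hT (hL σ hσ T)
    · intro hne'
      obtain ⟨g, hg1⟩ := (Subgroup.ne_bot_iff_exists_ne_one).mp hne'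
      obtain ⟨σ, hσ⟩ := absRestrictNormalHom_surjective' F (g : F ≃ₐ[K] F)
      refine ⟨σ, hσ ▸ g.2, ?_⟩
      by_contra hall
      push Not at hall
      -- `σ` fixes `E[2]`, hence the `eᵢ`, hence `g = 1`
      have hσ2 : ∀ (P : geomPoints W), (2 : ℕ) • P = 0 → σ • P = P := fun P hP ↦
        congrArg Subtype.val (hall ⟨P, (AddSubgroup.torsionBy.nsmul_iff (A := geomPoints W)).mpr hP⟩)
      have hfe : ∀ {e : AlgebraicClosure K} (he' : e ∈ F), (e = e₁ ∨ e = e₂ ∨ e = e₃) →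
          ((g : F ≃ₐ[K] F) ⟨e, he'⟩) = ⟨e, he'⟩ := by
        intro e he' hor
        apply Subtype.ext
        rw [← hσ, hres]
        exact W.smul_eq_self_of_forall_smul_two_torsion_eq σ hσ2 (eval_eq_zero_of_roots_eq he hor)
      exact hg1 (Subtype.ext (hFgen _ (hfe he₁ (Or.inl rfl)) (hfe he₂ (Or.inr (Or.inl rfl)))
        (hfe he₃ (Or.inr (Or.inr rfl)))))
  -- the book's formula with its summands evaluated
  rw [W.swanConductorAt_rationalTate_eq_finsum_ite 2 h (by exact_mod_cast h2v) h𝔓 F hL]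
  -- each summand: `6/#G₀` for `i + 1 ≤ b`, `0` beyond
  set g₀ : ℝ := ((Nat.card ((𝔓.comap (F.integralClosureToAbsIntegers (𝓞 K))).ramificationSubgroup
    (F ≃ₐ[K] F) 0) : ℕ) : ℝ) with hg₀
  have hg₀pos : 0 < g₀ := by rw [hg₀]; exact_mod_cast Nat.card_pos
  have hg₀I : Nat.card ((𝔓.comap (F.integralClosureToAbsIntegers (𝓞 K))).ramificationSubgroup
      (F ≃ₐ[K] F) 0) = Nat.card ((𝔓.comap (F.integralClosureToAbsIntegers (𝓞 K))).inertia
      (F ≃ₐ[K] F)) := by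
    rw [Ideal.ramificationSubgroup_zero]
  have hterm : ∀ i : ℕ,
      ((Nat.card ((𝔓.comap (F.integralClosureToAbsIntegers (𝓞 K))).ramificationSubgroup (F ≃ₐ[K] F)
        (i + 1)) : ℕ) : ℝ) / g₀ *
          (if (∃ σ : absoluteGaloisGroup K, absRestrictNormalHom F σ ∈
              (𝔓.comap (F.integralClosureToAbsIntegers (𝓞 K))).ramificationSubgroup (F ≃ₐ[K] F)
                (i + 1) ∧ ∃ T : geomTorsion W (2 : ℕ), σ • T ≠ T)
            then (2 : ℝ) else 0) =
        (if i + 1 ≤ b then 6 / g₀ else 0) := by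
    intro i
    by_cases hib : i + 1 ≤ b
    · have hne1 : (𝔓.comap (F.integralClosureToAbsIntegers (𝓞 K))).ramificationSubgroup (F ≃ₐ[K] F) (i + 1) ≠ ⊥ := (hne (i + 1) (by omega)).mpr hib
      rw [if_pos ((hcond (i + 1)).mpr hne1), if_pos hib, hcard3 (i + 1) (by omega) hib]
      push_cast
      ring
    · have hbot : (𝔓.comap (F.integralClosureToAbsIntegers (𝓞 K))).ramificationSubgroup (F ≃ₐ[K] F) (i + 1) = ⊥ := by
        by_contra hne1
        exact hib ((hne (i + 1) (by omega)).mp hne1)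
      rw [if_neg (fun hc ↦ (hcond (i + 1)).mp hc hbot), if_neg hib, mul_zero]
  simp_rw [hterm]
  rw [finsum_eq_sum_of_support_subset (s := Finset.range b)]
  · rw [Finset.sum_ite, Finset.sum_const_zero, add_zero, Finset.sum_const]
    have hfilter : (Finset.range b).filter (fun i ↦ i + 1 ≤ b) = Finset.range b := by
      ext i; simp only [Finset.mem_filter, Finset.mem_range]; omega
    rw [hfilter, Finset.card_range, nsmul_eq_mul]
    -- `b · 6/g₀ = n - 2` from `6b = g₀ (n - 2)`
    have h6b' : (6 : ℝ) * b = g₀ * ((n - 2 : ℕ) : ℝ) := by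
      rw [hg₀, hg₀I]; exact_mod_cast h6b
    field_simp
    linarith
  · intro i hi
    rw [Function.mem_support] at hi
    simp only [Finset.coe_range, Set.mem_Iio]
    by_contra h'
    exact hi (if_neg (by omega))

end WeierstrassCurve

end
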